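import Summits.NavierStokesRegularity.FluidComputer.AbcCrayaAssembly
import Summits.NavierStokesRegularity.FluidComputer.CrayaCubes
import Summits.NavierStokesRegularity.FluidComputer.SkewCutGalerkinFromResolventData

/-!
# The X0 chain for the full linearised ABC operator in Craya coordinates, END-TO-END FROM MATRIX
# DATA: the bracket-end hypothesis `hinj` of the g5 ASSEMBLY discharged by Theorem-R data on cubes
(instab3 g6 — implementation 1 of the skew-cut X0 certifier, cell `ns-blowup`, 2026-08-27)

HONEST FRAMING (human rulings D-0035/D-0074): nothing here is a claim about Navier–Stokes blow-up.
WHAT THIS IS NOT: not NS evidence; MODEL lane; no certificate, printed number or census word is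
used or moved. `AbcCrayaAssembly.exists_isLinNSEigenvalue_abcFlow_of_craya_sections` (instab3 g5)
instantiated the abstract X0 chain on the Craya index set for the FULL (class-free) linearised ABC
operator and left two certificate-side hypotheses: the normalised section eigenpairs in `[a, e]` and
the OPERATOR-form Theorem 1′(a) injectivity `hinj` at the two ends. profile-cert-3 g6's
`SkewCutGalerkinFromResolventData.exists_smooth_eigenvector_Ioo_of_sections_of_resolvent_data`
replaces `hinj` by MATRIX data (Theorem R: a left inverse of the Galerkin matrix `z·1 − L_K` with
bounds `α, β_B, β_C`, the shell inequality with `MU2 > 0`, the tail constant, and the SECTION pairing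
bound). Here the two are composed for `abcFlow 1 1 1`:

* `section_pairing_abcCrayaMatrix_le` (§13): the section pairing hypothesis `hA` with `s = √2` for the
  certifier's matrix, from g5's `abs_re_sum_conj_mul_abcCrayaMatrix_le` (implementation 2's Cartesian
  strain bound transported) — DISCHARGED, not assumed;
* `exists_isLinNSEigenvalue_abcFlow_of_craya_resolvent_data` (§14): END-TO-END with EVERY remaining
  hypothesis MATRIX-SHAPED about the Lean matrix `abcCrayaMatrix 1 1 1` and the levels `−ν|k|²`:
  section eigenpairs on a monotone exhausting family of finite index sets, and at each end `z ∈ {a, e}`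
  Theorem-R data on a CUBE head `crayaCube K_z` with the SHELL `crayaCube (K_z+1) ∖ crayaCube K_z`
  and the tail constant as the single transcribed inequality `MU2 ≤ z + ν (K_z + 2)² − √2`
  (`CrayaCubes.tail_constant_of_not_mem_crayaCube`); conclusion: `∃ λ ∈ (a, e)`,
  `Torus.IsLinNSEigenvalue (ν/(2π)) (Torus.abcFlow 1 1 1) (2πλ)` — the hypothesis of
  `AbcLyapunovInstability.isLyapunovUnstable_abcFlow_of_eigenvalue`.

This is the class-free template: the CERTIFIED object is the class-II compression (instab4 g6,
Cartesian coordinates, `AbcClassII*`), whose matrices are real in a J-real basis so that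
`SkewCutGalerkinRealShell` applies; for the full operator the Craya matrix is complex and the data
stay complex-quantified. Mathlib + tree files only; no definitions.
-/

noncomputable section

open scoped BigOperators InnerProductSpace ComplexConjugate Matrix
open Finset Matrix Filter Topology

namespace Summit.NavierStokesRegularity.FluidComputer.AbcCrayaEnds

open Literature.Analysis.FluidPDE Literature.Analysis.FluidPDE.SteadyLattice
open Literature.Analysis.FunctionSpaces Literature.Analysis.FunctionSpaces.Torus
open Summit.NavierStokesRegularity.FluidComputer.CrayaFrames
open Summit.NavierStokesRegularity.FluidComputer.AbcCrayaMatrix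
open Summit.NavierStokesRegularity.FluidComputer.AbcCrayaAssembly
open Summit.NavierStokesRegularity.FluidComputer.CrayaCubes

/-! ### §13 The SECTION pairing hypothesis for the certifier's matrix (`s = √2`) -/

/-- Row action restricted to a finite set: for `u` and a finite `G ∋ i`-independent set,
`∑_{j ∈ band(i)} A_ij (u·1_G)_j = ∑_{j ∈ G} A_ij u_j` (the matrix vanishes off the band). -/
theorem sum_crayaNbr_indicator_eq (A B C : ℝ) (G : Finset CrayaIdx) (u : CrayaIdx → ℂ)
    (i : CrayaIdx) :
    ∑ j ∈ crayaNbr i, abcCrayaMatrix A B C i j * (if j ∈ G then u j else 0) =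
      ∑ j ∈ G, abcCrayaMatrix A B C i j * u j := by
  classical
  have h1 : ∑ j ∈ crayaNbr i, abcCrayaMatrix A B C i j * (if j ∈ G then u j else 0) =
      ∑ j ∈ crayaNbr i ∪ G, abcCrayaMatrix A B C i j * (if j ∈ G then u j else 0) :=
    Finset.sum_subset Finset.subset_union_left fun j _ hj => by
      rw [abcCrayaMatrix_eq_zero_of_not_mem A B C hj, zero_mul]
  have h2 : ∑ j ∈ G, abcCrayaMatrix A B C i j * (if j ∈ G then u j else 0) =
      ∑ j ∈ crayaNbr i ∪ G, abcCrayaMatrix A B C i j * (if j ∈ G then u j else 0) :=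
    Finset.sum_subset Finset.subset_union_right fun j _ hj => by
      rw [if_neg hj, mul_zero]
  rw [h1, ← h2]
  exact Finset.sum_congr rfl fun j hj => by rw [if_pos hj]

/-- **The section pairing hypothesis `hA` of the matrix-data X0 chain, DISCHARGED for the
certifier's matrix of `abcFlow 1 1 1` with `s = √2`**: for every finite index set `G` and every
coefficient vector `u`, `Re ∑_{i,j ∈ G} conj(u_i) A_ij u_j ≤ √2 ∑_{i ∈ G} |u_i|²`
(g5 `abs_re_sum_conj_mul_abcCrayaMatrix_le` applied to `u·1_G`). MODEL statement; not NS. -/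
theorem section_pairing_abcCrayaMatrix_le (G : Finset CrayaIdx) (u : CrayaIdx → ℂ) :
    RCLike.re (∑ i ∈ G, ∑ j ∈ G, conj (u i) * abcCrayaMatrix 1 1 1 i j * u j) ≤
      Real.sqrt 2 * ∑ i ∈ G, ‖u i‖ ^ 2 := by
  classical
  set v : CrayaIdx → ℂ := fun i => if i ∈ G then u i else 0 with hvdef
  have hvG : ∀ i ∉ G, v i = 0 := fun i hi => by rw [hvdef]; dsimp only; rw [if_neg hi]
  have key := abs_re_sum_conj_mul_abcCrayaMatrix_le v G hvG
  have hlhs : ∑ i ∈ G, conj (v i) * ∑ j ∈ crayaNbr i, abcCrayaMatrix 1 1 1 i j * v j =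
      ∑ i ∈ G, ∑ j ∈ G, conj (u i) * abcCrayaMatrix 1 1 1 i j * u j := by
    refine Finset.sum_congr rfl fun i hi => ?_
    rw [hvdef]; dsimp only
    rw [if_pos hi, sum_crayaNbr_indicator_eq 1 1 1 G u i, Finset.mul_sum]
    exact Finset.sum_congr rfl fun j _ => by ring
  have hrhs : ∑ i ∈ G, ‖v i‖ ^ 2 = ∑ i ∈ G, ‖u i‖ ^ 2 :=
    Finset.sum_congr rfl fun i hi => by rw [hvdef]; dsimp only; rw [if_pos hi]
  rw [hlhs, hrhs] at key
  rw [RCLike.re_to_complex]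
  exact (le_abs_self _).trans key

/-! ### §14 END-TO-END for the full operator from matrix data (cube heads, shells, tail numbers) -/

/-- **END-TO-END, full linearised ABC operator (`abcFlow 1 1 1`) in Craya coordinates, FROM MATRIX
DATA.** Hypotheses, all about the Lean matrix `A = abcCrayaMatrix 1 1 1` and the levels
`ℓ_i = −ν|k_i|²`: (i) a base point `x₀ ≥ 1` with `(324 √(1+ν⁻¹))² < x₀` and its resolvent symbol
`d_i = (x₀ + ν|k_i|²)⁻¹`; (ii) normalised eigenpairs of the sections `[ℓ_i δ_ij + A_ij]_{F_n}` on a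
monotone exhausting family of finite index sets with eigenvalues in `[a, e]` and a uniform graph
bound; (iii) at each end `z ∈ {a, e}` THEOREM-R DATA on a cube head `crayaCube K_z`: a left inverse
`Binv` of the section matrix `[(z − ℓ_j) δ_ij − A_ij]` on the cube, bounds `α, β_B, β_C`, the SHELL
inequality with constant `MU2 > 0` on the shell `crayaCube (K_z+1) ∖ crayaCube K_z` (cross term
`Re ∑ conj((C Binv B u)_i) u_i` included), and the single tail number `MU2 ≤ z + ν (K_z+2)² − √2`.
The structural data (band, growth, Schur sums, weights, synthesis) are g5's ASSEMBLY; the pairing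
`s = √2` is §13; the tail constant is `CrayaCubes.tail_constant_of_not_mem_crayaCube`. Conclusion:
a classical eigenvalue `2πλ`, `λ ∈ (a, e)`, of the unit-torus linearisation about `abcFlow 1 1 1`
with viscosity `ν/(2π)`. MODEL statement; not NS; no certificate is moved (none exists for the
class-free operator — this is the template the class-II chain specialises). -/
theorem exists_isLinNSEigenvalue_abcFlow_of_craya_resolvent_data {ν : ℝ} (hν : 0 < ν)
    {H : Type*} [NormedAddCommGroup H] [InnerProductSpace ℂ H] [CompleteSpace H]
    (b : HilbertBasis CrayaIdx ℂ H)
    -- base point and resolvent symbol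
    (x₀ : ℝ) (hx₀ : 1 ≤ x₀) (hxK : (324 * Real.sqrt (1 + ν⁻¹)) ^ 2 < x₀)
    (d : lp (fun _ : CrayaIdx => ℂ) ⊤)
    (hdform : ∀ i : CrayaIdx, d i = (((x₀ - -(ν * freqNormSq i.1.1))⁻¹ : ℝ) : ℂ))
    (hd : ∀ i : CrayaIdx, d i * ((x₀ : ℂ) - ((-(ν * freqNormSq i.1.1) : ℝ) : ℂ)) = 1)
    (hd0 : Tendsto (fun i => ‖d i‖) cofinite (𝓝 0))
    -- normalised section eigenpairs in `[a, e]` with a uniform graph bound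
    (F : ℕ → Finset CrayaIdx) (hF : Monotone F) (hFex : ∀ i, ∃ n, i ∈ F n)
    (c : ℕ → CrayaIdx → ℂ) (xs : ℕ → ℝ) {a e : ℝ} (hxs : ∀ n, xs n ∈ Set.Icc a e)
    (heig : ∀ n, ∀ i ∈ F n, ((-(ν * freqNormSq i.1.1) : ℝ) : ℂ) * c n i +
      ∑ j ∈ F n, abcCrayaMatrix 1 1 1 i j * c n j = (xs n : ℂ) * c n i)
    (hnorm : ∀ n, ∑ j ∈ F n, ‖c n j‖ ^ 2 = 1) {Cg : ℝ} (hCg : 0 ≤ Cg)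
    (hgraph : ∀ n, ∑ j ∈ F n, ‖((x₀ : ℂ) - ((-(ν * freqNormSq j.1.1) : ℝ) : ℂ)) * c n j‖ ^ 2 ≤ Cg ^ 2)
    -- Theorem-R data at the end `a` on the cube head `crayaCube Ka`
    (Ka : ℕ) (Binva : (↥(crayaCube Ka) → ℂ) →ₗ[ℂ] (↥(crayaCube Ka) → ℂ))
    (hBinva : ∀ v : ↥(crayaCube Ka) → ℂ, Binva (fun i : ↥(crayaCube Ka) =>
      ((a : ℂ) - ((-(ν * freqNormSq i.1.1.1) : ℝ) : ℂ)) * v i -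
        ∑ j : ↥(crayaCube Ka), abcCrayaMatrix 1 1 1 i j * v j) = v)
    {αa βBa βCa : ℝ} (hαa : 0 ≤ αa) (hβBa : 0 ≤ βBa) (hβCa : 0 ≤ βCa)
    (hαMa : ∀ v : ↥(crayaCube Ka) → ℂ,
      ∑ j : ↥(crayaCube Ka), ‖Binva v j‖ ^ 2 ≤ αa ^ 2 * ∑ i : ↥(crayaCube Ka), ‖v i‖ ^ 2)
    (hβBMa : ∀ u : CrayaIdx → ℂ, ∑ j : ↥(crayaCube Ka), ‖Binva (fun i : ↥(crayaCube Ka) =>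
        -∑ j ∈ crayaNbr i \ crayaCube Ka, abcCrayaMatrix 1 1 1 i j * u j) j‖ ^ 2 ≤
        βBa ^ 2 * ∑ j ∈ (crayaCube Ka).biUnion crayaNbr \ crayaCube Ka, ‖u j‖ ^ 2)
    (hβCMa : ∀ v : ↥(crayaCube Ka) → ℂ, ∑ i ∈ (crayaCube Ka).biUnion crayaNbr \ crayaCube Ka,
      ‖∑ j : ↥(crayaCube Ka), abcCrayaMatrix 1 1 1 i j * Binva v j‖ ^ 2 ≤
        βCa ^ 2 * ∑ i : ↥(crayaCube Ka), ‖v i‖ ^ 2)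
    {MU2a : ℝ} (hMU2a : 0 < MU2a)
    (hshellMa : ∀ u : CrayaIdx → ℂ, (∀ i ∈ crayaCube Ka, u i = 0) →
      MU2a * ∑ i ∈ crayaCube (Ka + 1) \ crayaCube Ka, ‖u i‖ ^ 2 ≤
        ∑ i ∈ crayaCube (Ka + 1) \ crayaCube Ka,
          (a - -(ν * freqNormSq i.1.1) - Real.sqrt 2) * ‖u i‖ ^ 2 -
        RCLike.re (∑ i ∈ (crayaCube Ka).biUnion crayaNbr \ crayaCube Ka,
          conj (∑ j : ↥(crayaCube Ka), abcCrayaMatrix 1 1 1 i j *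
            Binva (fun i : ↥(crayaCube Ka) =>
              ∑ j ∈ crayaNbr i \ crayaCube Ka, abcCrayaMatrix 1 1 1 i j * u j) j) * u i))
    (htaila : MU2a ≤ a + ν * ((Ka : ℝ) + 2) ^ 2 - Real.sqrt 2)
    -- Theorem-R data at the end `e` on the cube head `crayaCube Ke`
    (Ke : ℕ) (Binve : (↥(crayaCube Ke) → ℂ) →ₗ[ℂ] (↥(crayaCube Ke) → ℂ))
    (hBinve : ∀ v : ↥(crayaCube Ke) → ℂ, Binve (fun i : ↥(crayaCube Ke) =>
      ((e : ℂ) - ((-(ν * freqNormSq i.1.1.1) : ℝ) : ℂ)) * v i -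
        ∑ j : ↥(crayaCube Ke), abcCrayaMatrix 1 1 1 i j * v j) = v)
    {αe βBe βCe : ℝ} (hαe : 0 ≤ αe) (hβBe : 0 ≤ βBe) (hβCe : 0 ≤ βCe)
    (hαMe : ∀ v : ↥(crayaCube Ke) → ℂ,
      ∑ j : ↥(crayaCube Ke), ‖Binve v j‖ ^ 2 ≤ αe ^ 2 * ∑ i : ↥(crayaCube Ke), ‖v i‖ ^ 2)
    (hβBMe : ∀ u : CrayaIdx → ℂ, ∑ j : ↥(crayaCube Ke), ‖Binve (fun i : ↥(crayaCube Ke) =>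
        -∑ j ∈ crayaNbr i \ crayaCube Ke, abcCrayaMatrix 1 1 1 i j * u j) j‖ ^ 2 ≤
        βBe ^ 2 * ∑ j ∈ (crayaCube Ke).biUnion crayaNbr \ crayaCube Ke, ‖u j‖ ^ 2)
    (hβCMe : ∀ v : ↥(crayaCube Ke) → ℂ, ∑ i ∈ (crayaCube Ke).biUnion crayaNbr \ crayaCube Ke,
      ‖∑ j : ↥(crayaCube Ke), abcCrayaMatrix 1 1 1 i j * Binve v j‖ ^ 2 ≤
        βCe ^ 2 * ∑ i : ↥(crayaCube Ke), ‖v i‖ ^ 2)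
    {MU2e : ℝ} (hMU2e : 0 < MU2e)
    (hshellMe : ∀ u : CrayaIdx → ℂ, (∀ i ∈ crayaCube Ke, u i = 0) →
      MU2e * ∑ i ∈ crayaCube (Ke + 1) \ crayaCube Ke, ‖u i‖ ^ 2 ≤
        ∑ i ∈ crayaCube (Ke + 1) \ crayaCube Ke,
          (e - -(ν * freqNormSq i.1.1) - Real.sqrt 2) * ‖u i‖ ^ 2 -
        RCLike.re (∑ i ∈ (crayaCube Ke).biUnion crayaNbr \ crayaCube Ke,
          conj (∑ j : ↥(crayaCube Ke), abcCrayaMatrix 1 1 1 i j *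
            Binve (fun i : ↥(crayaCube Ke) =>
              ∑ j ∈ crayaNbr i \ crayaCube Ke, abcCrayaMatrix 1 1 1 i j * u j) j) * u i))
    (htaile : MU2e ≤ e + ν * ((Ke : ℝ) + 2) ^ 2 - Real.sqrt 2) :
    ∃ lam ∈ Set.Ioo a e,
      Torus.IsLinNSEigenvalue (ν / (2 * Real.pi)) (Torus.abcFlow 1 1 1) (2 * Real.pi * lam) := by
  classical
  -- levels
  set ℓ : CrayaIdx → ℝ := fun i => -(ν * freqNormSq i.1.1) with hℓdef
  have hℓ0 : ∀ i, ℓ i ≤ 0 := fun i => by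
    rw [hℓdef]; exact neg_nonpos.mpr (mul_nonneg hν.le (freqNormSq_nonneg _))
  -- the matrix of the relative bound
  set t : CrayaIdx → CrayaIdx → ℂ := fun i j => abcCrayaMatrix 1 1 1 i j * d j with htdef
  have htA : ∀ i j, t i j * ((x₀ : ℂ) - (ℓ j : ℂ)) = abcCrayaMatrix 1 1 1 i j := fun i j => by
    rw [htdef]; dsimp only; rw [mul_assoc, hd j, mul_one]
  have ht0 : ∀ i j, j ∉ crayaNbr i → t i j = 0 := fun i j hj => by
    rw [htdef]; dsimp only; rw [abcCrayaMatrix_eq_zero_of_not_mem 1 1 1 hj, zero_mul]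
  -- weights
  set wgt : CrayaIdx → ℝ := fun i => Real.sqrt (1 + |ℓ i|) with hwgtdef
  have hw0 : ∀ i, 0 ≤ wgt i := fun i => Real.sqrt_nonneg _
  have hwℓ : ∀ i, wgt i ^ 2 ≤ 1 + |ℓ i| := fun i => by
    rw [hwgtdef]; dsimp only; rw [Real.sq_sqrt (by positivity)]
  -- growth `‖A_ij‖ ≤ K w_j`
  set K : ℝ := 9 * (|(1 : ℝ)| + |(1 : ℝ)| + |(1 : ℝ)|) * Real.sqrt (1 + ν⁻¹) with hKdef
  have hK27 : K = 27 * Real.sqrt (1 + ν⁻¹) := by rw [hKdef, abs_one]; ring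
  have hK : 0 ≤ K := by rw [hK27]; positivity
  have ha : ∀ i j, j ∈ crayaNbr i → ‖t i j * ((x₀ : ℂ) - (ℓ j : ℂ))‖ ≤ K * wgt j := by
    intro i j _
    rw [htA]
    calc ‖abcCrayaMatrix 1 1 1 i j‖
        ≤ 9 * (|(1 : ℝ)| + |(1 : ℝ)| + |(1 : ℝ)|) * sobolevWeight 1 j.1.1 :=
          norm_abcCrayaMatrix_le 1 1 1 i j
      _ ≤ 9 * (|(1 : ℝ)| + |(1 : ℝ)| + |(1 : ℝ)|) * (Real.sqrt (1 + ν⁻¹) * wgt j) :=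
          mul_le_mul_of_nonneg_left (sobolevWeight_le_sqrt_mul j.1.1 hν) (by positivity)
      _ = K * wgt j := by rw [hKdef]; ring
  -- band-comparable weights
  have hL : ∀ i j, j ∈ crayaNbr i → wgt i ≤ Real.sqrt (2 * (1 + ν)) * wgt j := by
    intro i j hj
    have hq : ∑ m, (((i.1.1 m : ℤ) : ℝ) - ((j.1.1 m : ℤ) : ℝ)) ^ 2 ≤ 1 := by
      have h := freqNormSq_sub_of_mem_crayaNbr hj
      rw [freqNormSq] at h
      simp only [Pi.sub_apply, Int.cast_sub] at h
      exact h.le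
    have h := SkewCutGalerkinLattice.weight_le_of_neighbour hν.le i.1.1 j.1.1 hq
    simpa only [hwgtdef, hℓdef, freqNormSq] using h
  -- weight/symbol product `M = 1/√x₀`
  have hM : ∀ i, ‖d i‖ * wgt i ≤ 1 / Real.sqrt x₀ := by
    intro i
    have hpos : 0 < x₀ - ℓ i := by linarith [hℓ0 i]
    have hn : ‖d i‖ = (x₀ - ℓ i)⁻¹ := by
      rw [hdform i, Complex.norm_real, Real.norm_eq_abs, abs_of_pos (inv_pos.mpr hpos)]
    rw [hn]
    exact SkewCutGalerkinLattice.weight_mul_symbol_le (hℓ0 i) hx₀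
  -- Schur data
  have hq12 : ((12 : ℕ) : ℝ) * K * (1 / Real.sqrt x₀) < 1 := by
    have hx0 : 0 < x₀ := by linarith
    have hsx : 0 < Real.sqrt x₀ := Real.sqrt_pos.mpr hx0
    have h12K : 0 ≤ 12 * K := by positivity
    have h324 : 12 * K = 324 * Real.sqrt (1 + ν⁻¹) := by rw [hK27]; ring
    have hlt : 12 * K < Real.sqrt x₀ := by
      rw [← Real.sqrt_sq h12K, h324]
      exact Real.sqrt_lt_sqrt (sq_nonneg _) hxK
    rw [Nat.cast_ofNat, mul_one_div, div_lt_one hsx]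
    exact hlt
  obtain ⟨hrow, hR, hcol, hC₀, hR0, hq⟩ :=
    SkewCutGalerkinLattice.schur_data_of_band t ℓ x₀ d hd crayaNbr mem_crayaNbr_comm
      card_crayaNbr_le ht0 wgt hK (by positivity) ha hM hq12
  -- section eigen-equations in the chain's form
  have heig' : ∀ n, ∀ i ∈ F n, (ℓ i : ℂ) * c n i +
      ∑ j ∈ F n, (t i j * ((x₀ : ℂ) - (ℓ j : ℂ))) * c n j = (xs n : ℂ) * c n i := by
    intro n i hi
    simp_rw [htA]
    exact heig n i hi
  -- the section pairing bound `s = √2` (§13)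
  have hA : ∀ (G : Finset CrayaIdx) (u : CrayaIdx → ℂ),
      RCLike.re (∑ i ∈ G, ∑ j ∈ G, conj (u i) * (t i j * ((x₀ : ℂ) - (ℓ j : ℂ))) * u j) ≤
        Real.sqrt 2 * ∑ i ∈ G, ‖u i‖ ^ 2 := by
    intro G u
    simp_rw [htA]
    exact section_pairing_abcCrayaMatrix_le G u
  -- tail constants from the single transcribed numbers
  have htaila' : ∀ i, i ∉ crayaCube Ka → i ∉ crayaCube (Ka + 1) \ crayaCube Ka →
      MU2a ≤ a - ℓ i - Real.sqrt 2 := by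
    intro i hi hi'
    have hi2 : i ∉ crayaCube (Ka + 1) := fun h => hi' (Finset.mem_sdiff.mpr ⟨h, hi⟩)
    exact tail_constant_of_not_mem_crayaCube hν.le htaila hi2
  have htaile' : ∀ i, i ∉ crayaCube Ke → i ∉ crayaCube (Ke + 1) \ crayaCube Ke →
      MU2e ≤ e - ℓ i - Real.sqrt 2 := by
    intro i hi hi'
    have hi2 : i ∉ crayaCube (Ke + 1) := fun h => hi' (Finset.mem_sdiff.mpr ⟨h, hi⟩)
    exact tail_constant_of_not_mem_crayaCube hν.le htaile hi2
  -- the end data in the chain's syntax (`t_ij (x₀ − ℓ_j)` for `A_ij`, `ℓ_i` for `−ν|k_i|²`)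
  have hBinva' : ∀ v : ↥(crayaCube Ka) → ℂ, Binva (fun i : ↥(crayaCube Ka) =>
      ((a : ℂ) - (ℓ i : ℂ)) * v i -
        ∑ j : ↥(crayaCube Ka), (t i j * ((x₀ : ℂ) - (ℓ j : ℂ))) * v j) = v := by
    intro v; simp_rw [htA]; exact hBinva v
  have hβBMa' : ∀ u : CrayaIdx → ℂ, ∑ j : ↥(crayaCube Ka), ‖Binva (fun i : ↥(crayaCube Ka) =>
      -∑ j ∈ crayaNbr i \ crayaCube Ka, (t i j * ((x₀ : ℂ) - (ℓ j : ℂ))) * u j) j‖ ^ 2 ≤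
      βBa ^ 2 * ∑ j ∈ (crayaCube Ka).biUnion crayaNbr \ crayaCube Ka, ‖u j‖ ^ 2 := by
    intro u; simp_rw [htA]; exact hβBMa u
  have hβCMa' : ∀ v : ↥(crayaCube Ka) → ℂ, ∑ i ∈ (crayaCube Ka).biUnion crayaNbr \ crayaCube Ka,
      ‖∑ j : ↥(crayaCube Ka), (t i j * ((x₀ : ℂ) - (ℓ j : ℂ))) * Binva v j‖ ^ 2 ≤
      βCa ^ 2 * ∑ i : ↥(crayaCube Ka), ‖v i‖ ^ 2 := by
    intro v; simp_rw [htA]; exact hβCMa v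
  have hshellMa' : ∀ u : CrayaIdx → ℂ, (∀ i ∈ crayaCube Ka, u i = 0) →
      MU2a * ∑ i ∈ crayaCube (Ka + 1) \ crayaCube Ka, ‖u i‖ ^ 2 ≤
        ∑ i ∈ crayaCube (Ka + 1) \ crayaCube Ka, (a - ℓ i - Real.sqrt 2) * ‖u i‖ ^ 2 -
        RCLike.re (∑ i ∈ (crayaCube Ka).biUnion crayaNbr \ crayaCube Ka,
          conj (∑ j : ↥(crayaCube Ka), (t i j * ((x₀ : ℂ) - (ℓ j : ℂ))) *
            Binva (fun i : ↥(crayaCube Ka) =>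
              ∑ j ∈ crayaNbr i \ crayaCube Ka, (t i j * ((x₀ : ℂ) - (ℓ j : ℂ))) * u j) j) * u i) := by
    intro u hu; simp_rw [htA]; exact hshellMa u hu
  have hBinve' : ∀ v : ↥(crayaCube Ke) → ℂ, Binve (fun i : ↥(crayaCube Ke) =>
      ((e : ℂ) - (ℓ i : ℂ)) * v i -
        ∑ j : ↥(crayaCube Ke), (t i j * ((x₀ : ℂ) - (ℓ j : ℂ))) * v j) = v := by
    intro v; simp_rw [htA]; exact hBinve v
  have hβBMe' : ∀ u : CrayaIdx → ℂ, ∑ j : ↥(crayaCube Ke), ‖Binve (fun i : ↥(crayaCube Ke) =>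
      -∑ j ∈ crayaNbr i \ crayaCube Ke, (t i j * ((x₀ : ℂ) - (ℓ j : ℂ))) * u j) j‖ ^ 2 ≤
      βBe ^ 2 * ∑ j ∈ (crayaCube Ke).biUnion crayaNbr \ crayaCube Ke, ‖u j‖ ^ 2 := by
    intro u; simp_rw [htA]; exact hβBMe u
  have hβCMe' : ∀ v : ↥(crayaCube Ke) → ℂ, ∑ i ∈ (crayaCube Ke).biUnion crayaNbr \ crayaCube Ke,
      ‖∑ j : ↥(crayaCube Ke), (t i j * ((x₀ : ℂ) - (ℓ j : ℂ))) * Binve v j‖ ^ 2 ≤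
      βCe ^ 2 * ∑ i : ↥(crayaCube Ke), ‖v i‖ ^ 2 := by
    intro v; simp_rw [htA]; exact hβCMe v
  have hshellMe' : ∀ u : CrayaIdx → ℂ, (∀ i ∈ crayaCube Ke, u i = 0) →
      MU2e * ∑ i ∈ crayaCube (Ke + 1) \ crayaCube Ke, ‖u i‖ ^ 2 ≤
        ∑ i ∈ crayaCube (Ke + 1) \ crayaCube Ke, (e - ℓ i - Real.sqrt 2) * ‖u i‖ ^ 2 -
        RCLike.re (∑ i ∈ (crayaCube Ke).biUnion crayaNbr \ crayaCube Ke,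
          conj (∑ j : ↥(crayaCube Ke), (t i j * ((x₀ : ℂ) - (ℓ j : ℂ))) *
            Binve (fun i : ↥(crayaCube Ke) =>
              ∑ j ∈ crayaNbr i \ crayaCube Ke, (t i j * ((x₀ : ℂ) - (ℓ j : ℂ))) * u j) j) * u i) := by
    intro u hu; simp_rw [htA]; exact hshellMe u hu
  -- run the matrix-data chain
  obtain ⟨T, -, -, lam, hlam, v, hv1, heigv, hreg⟩ :=
    SkewCutGalerkinFromResolventData.exists_smooth_eigenvector_Ioo_of_sections_of_resolvent_data b ℓ
      x₀ d hd hd0 t hrow hR hcol hC₀ hR0 hR0 hq crayaNbr mem_crayaNbr_comm card_crayaNbr_le ht0 wgt hw0 hwℓ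
      hK ha (Real.sqrt_nonneg _) hL hM F hF hFex c xs hxs heig' hnorm hCg hgraph hA
      (crayaCube Ka) Binva hBinva' hαa hβBa hβCa hαMa hβBMa' hβCMa' hMU2a
      (crayaCube (Ka + 1) \ crayaCube Ka) hshellMa' htaila'
      (crayaCube Ke) Binve hBinve' hαe hβBe hβCe hαMe hβBMe' hβCMe' hMU2e
      (crayaCube (Ke + 1) \ crayaCube Ke) hshellMe' htaile'
  refine ⟨lam, hlam, ?_⟩
  -- synthesis, as in g5's ASSEMBLY
  set w : CrayaIdx → ℂ := fun i => ⟪b i, v⟫_ℂ with hwdef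
  have hwne : w ≠ 0 := by
    intro hw
    have hv0 : v = 0 := by
      apply b.repr.injective
      rw [map_zero]
      ext i
      rw [b.repr_apply_apply]
      exact congr_fun hw i
    rw [hv0, norm_zero] at hv1
    exact zero_ne_one hv1
  have hreg' : ∀ s : ℕ, Summable fun i : CrayaIdx => (1 + ν * freqNormSq i.1.1) ^ s * ‖w i‖ ^ 2 := by
    intro s
    refine (hreg s).congr fun i => ?_
    have habs : |ℓ i| = ν * freqNormSq i.1.1 := by
      rw [hℓdef]; dsimp only
      rw [abs_neg, abs_of_nonneg (mul_nonneg hν.le (freqNormSq_nonneg _))]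
    rw [hwgtdef]; dsimp only
    rw [pow_mul, Real.sq_sqrt (by positivity), habs]
  refine isLinNSEigenvalue_abcFlow_of_craya_eigen' 1 1 1 hν hwne hreg' fun i => ?_
  have e2 : ∑ j ∈ crayaNbr i, abcCrayaMatrix 1 1 1 i j * w j =
      ∑ j ∈ crayaNbr i, (t i j * ((x₀ : ℂ) - (ℓ j : ℂ))) * ⟪b j, v⟫_ℂ :=
    Finset.sum_congr rfl fun j _ => by rw [htA]
  have hℓi : ((ℓ i : ℝ) : ℂ) = -(((ν * freqNormSq i.1.1 : ℝ)) : ℂ) := by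
    rw [hℓdef]; dsimp only; push_cast; ring
  rw [e2, ← hℓi]
  exact heigv i

end Summit.NavierStokesRegularity.FluidComputer.AbcCrayaEnds

end
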